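import Mathlib
import HarnessLib
import Summits.ResolutionOfSingularities.ResolutionOfSingularities.Theorems.WildQuotientsWildQuotientResolutionS1aModelNodeCentre
import Summits.ResolutionOfSingularities.ResolutionOfSingularities.Theorems.WildQuotientsWildQuotientResolutionS1aKillLeafCert
import Summits.ResolutionOfSingularities.ResolutionOfSingularities.Theorems.WildQuotientsWildQuotientResolutionS1aKillPowerChains

/-!
# S1a — THE NODE-CHART KILL OF POWER-CHAIN TYPE: a chart with a free model whose transported automorphism is of power-chain type with shift is killed by ONE move

[OURS · L1 W4.5c · lead-1 g14; plan-1 RULING R-F15k (b3) «the node-chart transport of the shifted family (`killsIn_one_of_nodeCert` ✓p703419 + KC5_δ through a free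
model)»] — NOT statements of the manuscript; counted 0; AI-level work, weaker than expert review. Crux stmt-ResolutionOfSingularities-17941 `CyclicQuotientFourfolds`, line
`s1a-logminvertex` v13 (`stub_reachLowerInFX`). The engine of the multi-shot classes (L_d, R-F15j/k): after any number of moves, a chart `W` of the current model
with node `DW` and free model `Φ : DW.B ≃ k[T_ι][1/h]` is killed by ONE further move as soon as the transported automorphism `conj Φ σ` is of POWER-CHAIN TYPE with
shift on a family of distinct variables `T_{v i}` — all hypotheses are checked in the localised polynomial ring.

* ★★★ `killsIn_one_of_modelNodePowerChains` — ✓`exists_isAdmissibleCentre_of_modelNode` (the centre; the realisation-independent data `𝒦, d`) + KC3_δ∘KC5_δ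
  ✓`cobordantKillCert_of_powerChains_shift` in the free model (node `(k[T][1/h], Φ_*𝒜, conj Φ σ, e_L)`) + ✓`killsIn_one_of_nodeCert` (residual element 1 on every
  producer chart). The σ-fixed cover is supplied as a function of the Veronese degree `d` (as in the D₄/a1 assemblies: `y d = (x^{d·p}, N^{d·…})`).
-/

set_option linter.dupNamespace false

noncomputable section

open CategoryTheory Limits AlgebraicGeometry TopologicalSpace Topology Opposite
open Literature.AlgebraicGeometry.Resolution Literature.AlgebraicGeometry.RelativeSpec
open MvPolynomial
open Summit.ResolutionOfSingularities.ResolutionOfSingularities.Theorems.WildQuotientResolution.S1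
open Summit.ResolutionOfSingularities.ResolutionOfSingularities.Theorems.WildQuotientResolution.S1.NodeAtlas
open Summit.ResolutionOfSingularities.ResolutionOfSingularities.Theorems.WildQuotientResolution.S1.ProducerStep
open Summit.ResolutionOfSingularities.ResolutionOfSingularities.Theorems.WildQuotientResolution.S1.CoarseChart
open Summit.ResolutionOfSingularities.ResolutionOfSingularities.Theorems.WildQuotientResolution.S1.ChartData
open Summit.ResolutionOfSingularities.ResolutionOfSingularities.Theorems.WildQuotientResolution.S1.GoodCharts
open Summit.ResolutionOfSingularities.ResolutionOfSingularities.Theorems.WildQuotientResolution.S1.KillableTransport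
open Summit.ResolutionOfSingularities.ResolutionOfSingularities.Theorems.WildQuotientResolution.S1.NodeTransport
open Summit.ResolutionOfSingularities.ResolutionOfSingularities.Theorems.WildQuotientResolution.S1.NpFrame
open Summit.ResolutionOfSingularities.ResolutionOfSingularities.Theorems.WildQuotientResolution.S1.KillCert
open Summit.ResolutionOfSingularities.ResolutionOfSingularities.Theorems.WildQuotientResolution.S1.ModelNode

namespace Summit.ResolutionOfSingularities.ResolutionOfSingularities.Theorems.WildQuotientResolution.S1.GameFrame.GModel

variable {p : ℕ} {X' X₁ : Scheme.{0}} {q : X' ⟶ X₁} {G : Type} [Group G] {ρ : G →* Aut X'} {g₀ : G}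

/-- ★★★ **THE NODE-CHART KILL OF POWER-CHAIN TYPE.** `M` a separated model, `W` a stable affine chart with node `DW` (`(conj Φ σ)^[p] = id`) and free model
`Φ : DW.B ≃ k[T_ι][1/h]`; node-atlas data `𝔄` on `M` with formal locus inside `W`; distinct variables `T_{v i}` (`c > 0`, homogeneous, weights `w > 0`, missing
`h = 0` at a point, traces closed in `M.V`) such that the transported automorphism `τ = conj Φ σ` is (a′)_δ-admissible for a boundary `β`, isolated
(`(T_v)^N ≤ (augIdeal τ : β)`) and of POWER-CHAIN TYPE (KC5_δ data); a `τ`-fixed cover `y d` of the cobordant blow-up for every Veronese degree `d`, with `hrad`.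
Then `KillsIn 1 M`. [OURS · L1 W4.5c · R-F15k (b3); NOT a statement of the manuscript] -/
theorem killsIn_one_of_modelNodePowerChains [Finite G] (hp : 0 < p) (hG : ∀ g : G, g ∈ Subgroup.zpowers g₀) (M : GModel p q G ρ g₀) [M.V.IsSeparated]
    (𝔄 : NodeAtlasData p M.act g₀) (W : M.act.StableAffineOpens) (DW : NodeData p M.act g₀ W) (h𝔄W : 𝔄.fLocus ⊆ (W.1 : Set M.V))
    {k : Type} [Field k] {ι : Type} [Finite ι] (hh : MvPolynomial ι k) (Φ : letI := DW.instCommRing; DW.B ≃+* Localization.Away hh)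
    (hσp : letI := DW.instCommRing; ∀ x, (⇑(conj Φ DW.σ))^[p] x = x)
    {c : ℕ} (hc : 0 < c) (v : Fin c → ι) (hv : Function.Injective v) (δ : Fin c → Π j : Fin DW.m, ZMod (DW.r j)) (w : Fin c → ℕ) (hw : ∀ i, 0 < w i)
    (hdeg : ∀ i, letI := DW.instCommRing; letI := DW.instGradedRing;
      algebraMap (MvPolynomial ι k) (Localization.Away hh) (X (v i)) ∈ mapGrading DW.𝒜 Φ (δ i))
    (g : ι → k) (hg : ∀ i, g (v i) = 0) (hu : MvPolynomial.eval g hh ≠ 0)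
    (β : Localization.Away hh) (sh : ℕ)
    (hadm : letI := DW.instCommRing; ∀ (n : ℕ) (z : Localization.Away hh),
      z ∈ (weightedFiltration (fun i => algebraMap (MvPolynomial ι k) (Localization.Away hh) (X (v i))) w).ideal n →
        conj Φ DW.σ z - z ∈ Ideal.span {β} * (weightedFiltration (fun i => algebraMap (MvPolynomial ι k) (Localization.Away hh) (X (v i))) w).ideal (n + sh))
    (hiso : letI := DW.instCommRing; ∃ N : ℕ, Ideal.span (Set.range fun i => algebraMap (MvPolynomial ι k) (Localization.Away hh) (X (v i))) ^ N ≤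
      (augmentationIdeal (conj Φ DW.σ)).colon (Ideal.span {β}))
    (hchain : letI := DW.instCommRing; ∀ i, ∃ (mm : ℕ) (u hunit : Localization.Away hh), 0 < mm ∧ sh ≤ mm * w i ∧ IsUnit hunit ∧
      u ∈ (weightedFiltration (fun i => algebraMap (MvPolynomial ι k) (Localization.Away hh) (X (v i))) w).ideal (mm * w i - sh) ∧
      conj Φ DW.σ u - u - β * hunit * algebraMap (MvPolynomial ι k) (Localization.Away hh) (X (v i)) ^ mm ∈
        Ideal.span {β} * (weightedFiltration (fun i => algebraMap (MvPolynomial ι k) (Localization.Away hh) (X (v i))) w).ideal (mm * w i + 1))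
    (hcl : letI := DW.instCommRing; letI := DW.instGradedRing; letI := mapGradedRing DW.𝒜 Φ; ∀ n : ℕ, 0 < n →
      closure (M.V.zeroLocus (U := W.1)
          ((((traceFiltration (mapGrading DW.𝒜 Φ) (fun i => algebraMap (MvPolynomial ι k) (Localization.Away hh) (X (v i))) w).ideal n).comap
              ((DW.e.trans (zeroRingEquiv DW.𝒜 Φ) : Γ(M.V, W.1) ≃+* ↥(mapGrading DW.𝒜 Φ 0)) : Γ(M.V, W.1) →+* ↥(mapGrading DW.𝒜 Φ 0)) :
            Ideal Γ(M.V, W.1)) : Set Γ(M.V, W.1)) ∩ (W.1 : Set M.V)) ⊆ (W.1 : Set M.V))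
    {kk : ℕ} (hk : 0 < kk) {L : ℕ} (y : letI := DW.instCommRing; letI := DW.instGradedRing; ℕ → Fin L → ↥(mapGrading DW.𝒜 Φ 0))
    (hy : letI := DW.instCommRing; letI := DW.instGradedRing; letI := mapGradedRing DW.𝒜 Φ; ∀ d j,
      y d j ∈ (traceFiltration (mapGrading DW.𝒜 Φ) (fun i => algebraMap (MvPolynomial ι k) (Localization.Away hh) (X (v i))) w).ideal (d * kk))
    (hσy : letI := DW.instCommRing; letI := DW.instGradedRing; ∀ d j, conj Φ DW.σ (y d j : Localization.Away hh) = y d j)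
    (hrad : letI := DW.instCommRing; letI := DW.instGradedRing; letI := mapGradedRing DW.𝒜 Φ; ∀ d, 0 < d → ∀ i : Fin c,
      cobordantAlgebra.u' (fun i => algebraMap (MvPolynomial ι k) (Localization.Away hh) (X (v i))) w i ∈
        (Ideal.span (Set.range fun j => coverElement (mapGrading DW.𝒜 Φ) (fun i => algebraMap (MvPolynomial ι k) (Localization.Away hh) (X (v i))) w
          (d * kk) (y d j) (hy d j))).radical) :
    KillsIn 1 M := by
  classical
  letI := DW.instCommRing
  letI := DW.instGradedRing
  letI := mapGradedRing DW.𝒜 Φ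
  set f : Fin c → Localization.Away hh := fun i => algebraMap (MvPolynomial ι k) (Localization.Away hh) (X (v i)) with hfdef
  set eL : Γ(M.V, W.1) ≃+* ↥(mapGrading DW.𝒜 Φ 0) := DW.e.trans (zeroRingEquiv DW.𝒜 Φ) with heL
  -- the centre of the game (realisation-independent)
  have hσJ : ∀ n : ℕ, ((weightedFiltration f w).ideal n).map (conj Φ DW.σ : Localization.Away hh →+* Localization.Away hh) ≤
      (weightedFiltration f w).ideal n := map_le_of_admissible_shift f w (conj Φ DW.σ) sh β hadm
  obtain ⟨𝒦, d, hd, hadmC, -, h𝒦G, h𝒦O, hver, hsuppW⟩ :=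
    exists_isAdmissibleCentre_of_modelNode hG M W DW hh Φ hc v hv δ w hw hdeg g hg hu hσJ hcl
  -- the transported node
  have htame : IsTameNode p (Localization.Away hh) (mapGrading DW.𝒜 Φ) (conj Φ DW.σ) := isTameNode_map DW.𝒜 Φ p DW.σ DW.tame
  have hσ : ∀ t : Γ(M.V, W.1), ((eL ((M.act.aut g₀⁻¹).hom.appLE W.1 W.1 (W.2.1 g₀⁻¹).ge t) : ↥(mapGrading DW.𝒜 Φ 0)) : Localization.Away hh) =
      conj Φ DW.σ ((eL t : ↥(mapGrading DW.𝒜 Φ 0)) : Localization.Away hh) := fun t => by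
    change Φ ((DW.e (actO M.act W g₀ t) : ↥(DW.𝒜 0)) : DW.B) = Φ (DW.σ (Φ.symm (Φ ((DW.e t : ↥(DW.𝒜 0)) : DW.B))))
    rw [DW.intertwine t, Φ.symm_apply_apply]
  have hK1 : RingTheory.Sequence.IsRegular (Localization.Away hh) (List.ofFn f) := isRegular_algebraMap_X_away k hh v hv g hg hu
  have hK1' : IsRegularRing (Localization.Away hh ⧸ Ideal.span (Set.range f)) := isRegularRing_quotient_X_away k hh v
  -- the certificate in the free model (KC3_δ ∘ KC5_δ)
  have hcert : CobordantKillCert f w (conj Φ DW.σ) hσJ hp hσp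
      (algebraMap (Localization.Away hh) (↥(cobordantAlgebra f w)) β * cobordantAlgebra.s f w ^ sh) :=
    cobordantKillCert_of_powerChains_shift f w (conj Φ DW.σ) hσJ hp hσp sh β hadm hiso hchain
  exact killsIn_one_of_nodeCert hp hG M 𝔄 W DW.affine h𝔄W DW.r (mapGrading DW.𝒜 Φ) f w hdeg (conj Φ DW.σ) eL htame hσp hσ hw hK1 hK1' hσJ
    𝒦 d hadmC h𝒦G h𝒦O hver hsuppW hk (y d) (hy d) (hσy d) (hrad d hd) hcert

end Summit.ResolutionOfSingularities.ResolutionOfSingularities.Theorems.WildQuotientResolution.S1.GameFrame.GModel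

end
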